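import Summits.CriticalPhenomena.CardyFormulaZ2.Theorems.CardyComplexConeParafermionToSLESixFamiliesDiamondTouchLowerAssembly
import HarnessLib

/-!
# S3 (c), conditionally: the diagonal half-plane one-arm lower bound gives the free-side touch mass
# `freeTouchLower_of_diagArmLower : DiagHalfPlaneOneArmLower → FreeTouchLower` (line `potential-darboux-picard-diamond`)

Crux `ParafermionToSLESixFamilies` (stmt-CriticalPhenomena-11389), route `CardyComplexCone`, line
`potential-darboux-picard-diamond`, registered conditional helper of S3 `stub_closedPrecompactness` (conjunct (c),
`FreeTouchLower` of `…DiamondDefsR5`): along every admissible family of a marked diamond, the middle half of one free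
boundary segment carries renormalised touch mass `≥ c₀ > 0` eventually — GIVEN the diagonal half-plane one-arm lower bound
`DiagHalfPlaneOneArmLower` (`…FlipDefs`, `π◇(N) ≥ c N^{-1/3}` eventually; itself the kernel-checked consequence of
`IkhlefPonsaingFirstPassage`, `diagArmLower_of_ikhlefPonsaing`).

Proof (assembling parts 1–8, `…DiamondTouchLower*`). Take the free segment `[p, q]` of
`exists_isBdrySegment_subset_arc_one_of_isMarkedDiamond` (side `k`, length `L`) and a wired segment `[p₁, q₁]`
(`…TouchLowerWiredSegment`, side `k'`, length `L₁`). For small `δ` read the datum in the four side charts at once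
(`exists_fourCharts`; lattice box `{layerFn (j+2) ≤ n j}`, discrete boundary = two-layer frame, `…TouchLowerBox`), choose the
scale `m = ⌊κ√2/δ⌋` (`κ = min (L/16) (L₁/4) (min α β/4)`), strip width `w = m`, and the connector window of side `k'` inside
the bulk of `[p₁, q₁]` (whose boundary layer is made of `A`-sites, `eventually_arcs_near_wiredSegment`). For each of the
`N ≥ L/(4δ)` touch-row sites `x` of the middle half of `[p, q]` (`…TouchLowerCount`): `touchProb x ≥ c · P(armEv x 2m) ·
P(ring ∩ connector)` (`touchProb_ge_glue`: the arm, its U, the ring of four long strip crossings and the connector are glued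
by the planar crossing lemma into an open path of `bcBondConfig ω` from `x` to `A`; Harris–FKG), `P(ring ∩ connector) ≥ c_K`
(RSW at the fixed aspect ratio `K` of the diamond over `κ`, `real_ringConn_ge`), and `P(armEv x 2m) = P(arm[0, 2m]) ≥
½ π◇(2m + 1) ≥ ½ c (2m+1)^{-1/3} ≥ C δ^{1/3}` (`real_armEv_eq`, `real_arm_std_ge`, the hypothesis). Summing,
`touchMass ≥ δ^{2/3} · N · C′ δ^{1/3} ≥ C′ L/4 = c₀` (`touchMass_ge_of_row`).
-/

noncomputable section

namespace Summit.CriticalPhenomena.CardyFormulaZ2.Cruxes.ParafermionToSLESixFamilies.PotentialDarbouxPicardDiamond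

open scoped Topology BigOperators
open Filter Set Metric Complex MeasureTheory
open Literature.Probability Literature.Probability.LatticeModels Literature.Probability.Percolation
open Literature.Probability.LatticeModels.DiscreteDobrushin
open Literature.Probability.RandomPlanarGeometry
open Literature.Probability.Percolation.TrackExchange (col hgtOf)
open Summit.CriticalPhenomena.CardyFormulaZ2.Cruxes.ParafermionToSLESixFamilies.IicTraceFluxPairing

/-- The depth of `v` below the touch row of side `k` (last inside layer `n k`). -/
local notation3 "dp[" n ", " k ", " v "]" => (n : Fin 4 → ℤ) k - 2 - layerFn (k + 2) v
/-- The rotation of side `k`. -/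
local notation3 "SR[" k "]" => (![zdSignedPermIso (Equiv.swap 0 1) ![-1, 1], zdSignedPermIso 1 (fun _ => -1),
    zdSignedPermIso (Equiv.swap 0 1) ![1, -1], zdSignedPermIso 1 (fun _ => 1)] : Fin 4 → (zdGraph 2 ≃g zdGraph 2)) k
/-- The lattice automorphism based at the site `x` of side `k`. -/
local notation3 "SI[" k ", " x "]" => (zdShiftIso ((SR[k]).symm x)).trans SR[k]
/-- The angle of the drawing of side `k`. -/
local notation3 "SA[" k "]" => (![-(Real.pi / 2), Real.pi, Real.pi / 2, 0] : Fin 4 → ℝ) k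
/-- The isoradial drawing of side `k`. -/
local notation3 "SE[" n ", " k "]" => (gmEmbedding (fun _ => SA[k]) (fun _ => SA[k] + Real.pi / 2)).translate
    ((((n : Fin 4 → ℤ) k - 2 : ℤ) : ℂ) * I)
/-- The interior of the lattice box: depth `≥ 0` below all four touch rows. -/
local notation3 "boxI[" n "]" => {v : Site 2 | ∀ j : Fin 4, 0 ≤ dp[n, j, v]}
/-- The strip of depth `≤ w` along side `j`, inside the interior. -/
local notation3 "strip[" n ", " w ", " j "]" => {v : Site 2 | (∀ i : Fin 4, 0 ≤ dp[n, i, v]) ∧ dp[n, j, v] ≤ w}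
/-- The touch row of side `j` (depth `0`). -/
local notation3 "face[" n ", " j "]" => {v : Site 2 | dp[n, j, v] = 0}
/-- The crossing event of the strip of side `j` (the long way, from the touch row of side `j + 3` to that of `j + 1`). -/
local notation3 "crossEv[" n ", " w ", " j "]" => openCrossing strip[n, w, j] face[n, j + 3] face[n, j + 1]
/-- The ring event: all four strips are crossed the long way. -/
local notation3 "ringEv[" n ", " w "]" => ⋂ j : Fin 4, crossEv[n, w, j]
/-- The connector of side `k` at tangential position `lo`: the box `[lo, lo + w] × [−1, w]` of the frame of side `k`. -/
local notation3 "connQ[" n ", " w ", " k ", " lo "]" => {v : Site 2 | lo ≤ layerFn (k + 3) v ∧ layerFn (k + 3) v ≤ lo + w ∧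
    -1 ≤ dp[n, k, v] ∧ dp[n, k, v] ≤ w}
/-- The connector event: the connector is crossed from the boundary layer `dp = −1` to the depth `w`. -/
local notation3 "connEv[" n ", " w ", " k ", " lo "]" => openCrossing connQ[n, w, k, lo] {v : Site 2 | dp[n, k, v] = -1}
    {v : Site 2 | dp[n, k, v] = w}
/-- The arm event of the touch-row site `x` of side `k` to half-plane distance `N`. -/
local notation3 "armEv[" n ", " k ", " x ", " N "]" => openCrossing
    {v : Site 2 | 0 ≤ dp[n, k, v] ∧ max |layerFn (k + 3) v - layerFn (k + 3) x| (dp[n, k, v] - dp[n, k, x]) ≤ N} {x}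
    {v : Site 2 | max |layerFn (k + 3) v - layerFn (k + 3) x| (dp[n, k, v] - dp[n, k, x]) = N}
/-- The U event at scale `m` around the site `x` of side `k` (two pillars crossed across, one bar crossed along). -/
local notation3 "uEv[" n ", " k ", " x ", " m "]" =>
    openCrossing {v : Site 2 | layerFn (k + 3) x + m ≤ layerFn (k + 3) v ∧ layerFn (k + 3) v ≤ layerFn (k + 3) x + 2 * m ∧
        0 ≤ dp[n, k, v] ∧ dp[n, k, v] ≤ dp[n, k, x] + 2 * m} {v : Site 2 | dp[n, k, v] = 0}
        {v : Site 2 | dp[n, k, v] = dp[n, k, x] + 2 * m} ∩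
      openCrossing {v : Site 2 | layerFn (k + 3) x - 2 * m ≤ layerFn (k + 3) v ∧ layerFn (k + 3) v ≤ layerFn (k + 3) x + 2 * m ∧
        dp[n, k, x] + m ≤ dp[n, k, v] ∧ dp[n, k, v] ≤ dp[n, k, x] + 2 * m} {v : Site 2 | layerFn (k + 3) v = layerFn (k + 3) x - 2 * m}
        {v : Site 2 | layerFn (k + 3) v = layerFn (k + 3) x + 2 * m} ∩
      openCrossing {v : Site 2 | layerFn (k + 3) x - 2 * m ≤ layerFn (k + 3) v ∧ layerFn (k + 3) v ≤ layerFn (k + 3) x - m ∧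
        0 ≤ dp[n, k, v] ∧ dp[n, k, v] ≤ dp[n, k, x] + 2 * m} {v : Site 2 | dp[n, k, v] = 0}
        {v : Site 2 | dp[n, k, v] = dp[n, k, x] + 2 * m}
/-- The vertical connector event at `x`: the box `[tng x − m, tng x + m] × [0, 3m]` of side `k` is crossed across. -/
local notation3 "vEv[" n ", " k ", " x ", " m "]" => openCrossing
    {v : Site 2 | layerFn (k + 3) x - m ≤ layerFn (k + 3) v ∧ layerFn (k + 3) v ≤ layerFn (k + 3) x + m ∧ 0 ≤ dp[n, k, v] ∧
      dp[n, k, v] ≤ 3 * m} {v : Site 2 | dp[n, k, v] = 0} {v : Site 2 | dp[n, k, v] = 3 * m}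

/-- The lattice site with chart coordinates `(A, B)` of orientation `j` (meaningful for `A ≡ B (mod 2)`). -/
local notation3 "site[" j ", " A ", " B "]" => (((A : ℤ) - B) / 2) • cornerUnit (j + 1) + ((A + B) / 2) • cornerUnit (j + 2)

/-! ## The theorem -/


/-- **S3 (c), conditionally on the diagonal half-plane one-arm lower bound.** Along every admissible family of a marked
diamond, the middle half of one free boundary segment carries renormalised touch mass `≥ c₀ > 0` eventually in the mesh,
given `DiagHalfPlaneOneArmLower`. -/
theorem freeTouchLower_of_diagArmLower : Summit.CriticalPhenomena.CardyFormulaZ2.Cruxes.ParafermionToSLESixFamilies.FlipInvolutionReturnLaw.DiagHalfPlaneOneArmLower → FreeTouchLower := by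
  rintro ⟨cA, hcA, hev⟩ D hD Λ hΛ
  obtain ⟨c, α, β, hα, hβ, hcar⟩ := id hD
  -- the free and the wired segments and their side data
  obtain ⟨p, q, hpq, hsub⟩ := exists_isBdrySegment_subset_arc_one_of_isMarkedDiamond D hD
  obtain ⟨p₁, q₁, hpq₁, hsub₁⟩ := exists_isBdrySegment_subset_arc_zero_of_isMarkedDiamond D hD
  obtain ⟨k, s, t, hs, hst, ht, hP, hQ⟩ := segData_of_isBdrySegment hα hβ hcar hpq
  obtain ⟨k', s₁, t₁, hs₁, hst₁, ht₁, hP₁, hQ₁⟩ := segData_of_isBdrySegment hα hβ hcar hpq₁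
  have hLn : ‖q - p‖ = t - s := (sub_eq_of_segData c hP hQ).2 hst.le
  have hL0 : 0 < t - s := by linarith
  have hL₁0 : 0 < t₁ - s₁ := by linarith
  have hmin : 0 < min α β := lt_min hα hβ
  -- the constants
  obtain ⟨cg, hcg, mg, hglue⟩ := touchProb_ge_glue
  obtain ⟨κ, hκ0, hκL, hκL₁, hκm⟩ : ∃ κ : ℝ, 0 < κ ∧ κ ≤ (t - s) / 16 ∧ κ ≤ (t₁ - s₁) / 4 ∧ κ ≤ min α β / 4 :=
    ⟨min ((t - s) / 16) (min ((t₁ - s₁) / 4) (min α β / 4)), lt_min (by positivity) (lt_min (by positivity) (by positivity)),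
      min_le_left _ _, (min_le_right _ _).trans (min_le_left _ _), (min_le_right _ _).trans (min_le_right _ _)⟩
  obtain ⟨K, hKκ, hK0⟩ : ∃ K : ℕ, 4 * (α + β) + κ ≤ K * κ ∧ (0 : ℝ) < K := by
    refine ⟨⌈4 * (α + β) / κ⌉₊ + 1, ?_, by positivity⟩
    have hK : 4 * (α + β) / κ + 1 ≤ ((⌈4 * (α + β) / κ⌉₊ + 1 : ℕ) : ℝ) := by push_cast; linarith [Nat.le_ceil (4 * (α + β) / κ)]
    have := mul_le_mul_of_nonneg_right hK hκ0.le
    rwa [add_mul, div_mul_cancel₀ _ hκ0.ne', one_mul] at this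
  obtain ⟨cr, hcr, mr, hring⟩ := real_ringConn_ge K
  obtain ⟨N₀, hN₀⟩ := Filter.eventually_atTop.1 hev
  set C₁ : ℝ := cg * (1 / 2 * (cA * (3 * Real.sqrt 2 * κ) ^ (-((1:ℝ) / 3)))) * cr with hC₁
  have hC₁0 : 0 < C₁ := by positivity
  refine ⟨p, q, (t - s) / 4 * C₁, hpq, hsub, by positivity, ?_⟩
  -- the threshold on the mesh
  set Ms : ℝ := (mg : ℝ) + mr + N₀ with hMs
  have hMs0 : 0 ≤ Ms := by positivity
  obtain ⟨δ₁, hδ₁, hδ₁κ, hδ₁L, hδ₁L₁, hδ₁m, hδ₁K⟩ : ∃ δ₁ : ℝ, 0 < δ₁ ∧ δ₁ ≤ κ / (Ms + 2) ∧ δ₁ ≤ (t - s) / 60 ∧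
      δ₁ ≤ (t₁ - s₁) / 40 ∧ δ₁ ≤ min α β / 5 ∧ δ₁ ≤ (2 * (α + β) + κ) / K := by
    refine ⟨min (κ / (Ms + 2)) (min ((t - s) / 60) (min ((t₁ - s₁) / 40) (min (min α β / 5) ((2 * (α + β) + κ) / K)))),
      lt_min (by positivity) (lt_min (by positivity) (lt_min (by positivity) (lt_min (by positivity) (by positivity)))),
      min_le_left _ _, (min_le_right _ _).trans (min_le_left _ _),
      (min_le_right _ _).trans ((min_le_right _ _).trans (min_le_left _ _)),
      (min_le_right _ _).trans ((min_le_right _ _).trans ((min_le_right _ _).trans (min_le_left _ _))),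
      (min_le_right _ _).trans ((min_le_right _ _).trans ((min_le_right _ _).trans (min_le_right _ _)))⟩
  filter_upwards [eventually_mem_meshDomain_of_isMarkedDiamond D hD, hΛ.2.2.2.2.2,
    eventually_arcs_near_freeSegment D Λ hΛ p q hpq hsub ((t - s) / 8) (by positivity),
    eventually_arcs_near_wiredSegment hΛ hpq₁ hsub₁ (η := (t₁ - s₁) / 8) (by positivity), Ioo_mem_nhdsGT hδ₁]
    with δ hgood hE harcF harcW hδI
  obtain ⟨hδ, hδlt⟩ := hδI
  have hδκ : (Ms + 2) * δ ≤ κ := by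
    have := hδlt.le.trans hδ₁κ; rwa [le_div_iff₀ (by positivity), mul_comm] at this
  have hδL : δ ≤ (t - s) / 60 := hδlt.le.trans hδ₁L
  have hδL₁ : δ ≤ (t₁ - s₁) / 40 := hδlt.le.trans hδ₁L₁
  have hδmn : δ ≤ min α β / 5 := hδlt.le.trans hδ₁m
  have hδK : (K : ℝ) * δ ≤ 2 * (α + β) + κ := by
    have := hδlt.le.trans hδ₁K; rwa [le_div_iff₀ hK0, mul_comm] at this
  -- mesh quantities
  set h : ℝ := Real.sqrt 2 / 2 * δ with hhdef
  obtain ⟨hs2a, hs2b⟩ := sqrt_two_bounds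
  have hh0 : 0 < h := by positivity
  have hhδ : h ≤ δ := by rw [hhdef]; nlinarith only [hs2b, hδ.le]
  have hEδ : (Λ δ).δ = δ := hΛ.2.1 δ
  have hΩE : (Λ δ).Ω = D.carrier := hΛ.1 δ
  -- the four charts, the scale, the depths
  obtain ⟨X₀, Y₀, n, hch⟩ := exists_fourCharts c α β hδ
  have hdepth : ∀ j, 2 * sideHalfWidth α β j - 2 * h ≤ h * (n j + n (j + 2)) ∧ h * (n j + n (j + 2)) < 2 * sideHalfWidth α β j :=
    fun j => depth_bounds hch j
  obtain ⟨hmh, hmh', hmM, hκh⟩ := scale_facts hh0 hhδ hMs0 hδκ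
  set m : ℤ := ⌊κ / h⌋ with hmdef
  have hcast : ∀ a : ℕ, (a : ℝ) ≤ m → (a : ℤ) ≤ m := fun a ha => by exact_mod_cast ha
  have hmg0 : (0 : ℝ) ≤ mg := Nat.cast_nonneg mg
  have hmr0 : (0 : ℝ) ≤ mr := Nat.cast_nonneg mr
  have hN00 : (0 : ℝ) ≤ N₀ := Nat.cast_nonneg N₀
  rw [hMs] at hmM
  have hm_mg : (mg : ℤ) ≤ m := hcast mg (by linarith only [hmM, hmr0, hN00])
  have hm_mr : (mr : ℤ) ≤ m := hcast mr (by linarith only [hmM, hmg0, hN00])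
  have hm_N₀ : (N₀ : ℤ) ≤ m := hcast N₀ (by linarith only [hmM, hmg0, hmr0])
  have hm1 : 1 ≤ m := by exact_mod_cast (show ((1 : ℕ) : ℝ) ≤ m by push_cast; linarith only [hmM, hmg0, hmr0, hN00])
  have hm0 : 0 ≤ m := zero_le_one.trans hm1
  obtain ⟨hwT, h3T, h6, hKm⟩ := depth_facts hh0 hdepth hmh hmh' hκm (hhδ.trans hδmn) hKκ
    ((mul_le_mul_of_nonneg_left hhδ hK0.le).trans hδK)
  -- the connector window of the wired side
  obtain ⟨lo, hlo, hlo', hQA⟩ := connector_window hδ hch (E := Λ δ) hs₁ hst₁ ht₁ hP₁ hQ₁ harcW hm0 hmh hκL₁ hδL₁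
  -- the chart of the free side and its window
  obtain ⟨he', hboxk, hX', hY', hn, hn'⟩ := hch k
  obtain ⟨hpX, hqX, hpY, hqY, hYp, hYq⟩ := seg_frame c hs ht hP hQ
  have hYpq : -sideHalfLength α β k + s < -sideHalfLength α β k + t := by linarith only [hst]
  have hκ16 : κ ≤ (-sideHalfLength α β k + t - (-sideHalfLength α β k + s)) / 16 := by linarith only [hκL]
  have hδ60 : δ ≤ (-sideHalfLength α β k + t - (-sideHalfLength α β k + s)) / 60 := by linarith only [hδL]
  have hL40 : 40 * δ ≤ -sideHalfLength α β k + t - (-sideHalfLength α β k + s) := by linarith only [hδL, hδ.le]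
  have hArc : ∀ x : Site 2, n k - 4 ≤ layerFn (k + 2) x → layerFn (k + 2) x ≤ n k →
      -sideHalfLength α β k + s + (-sideHalfLength α β k + t - (-sideHalfLength α β k + s)) / 8 ≤
        ((meshPoint δ x - c) * (exp (-(Real.pi / 4 : ℝ) * I) * sideFrame k)).im →
      ((meshPoint δ x - c) * (exp (-(Real.pi / 4 : ℝ) * I) * sideFrame k)).im ≤
        -sideHalfLength α β k + t - (-sideHalfLength α β k + t - (-sideHalfLength α β k + s)) / 8 →
      x ∉ (Λ δ).zdArcA ∧ (x ∈ (Λ δ).zdBoundary → x ∈ (Λ δ).zdArcB) := by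
    intro x h1 h2 h3 h4
    obtain ⟨hd, hp, hq⟩ := near_segment_of_chart he' hδ hpX hqX hpY hqY hYpq hX' hn hn'
      (by positivity : (0:ℝ) ≤ (t - s) / 8) x 4 (by exact_mod_cast h1) h2 (by linarith only [h3]) (by linarith only [h4])
    exact harcF x (by push_cast at hd; linarith only [hd, hδ.le]) hp hq
  have hΩ' : (Λ δ).Ω = {z : ℂ | |((z - c) * (exp (-(Real.pi / 4 : ℝ) * I) * sideFrame k)).re| < sideHalfWidth α β k ∧
      |((z - c) * (exp (-(Real.pi / 4 : ℝ) * I) * sideFrame k)).im| < sideHalfLength α β k} := by rw [hΩE, hcar]; exact hboxk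
  have hgood' : ∀ x : Site 2, meshPoint δ x ∈ (Λ δ).Ω → x ∈ meshDomain (Λ δ).Ω δ := by rw [hΩE]; exact hgood
  have hα4 : 4 * δ ≤ sideHalfWidth α β k := by linarith only [min_le_sideHalfWidth α β k, hδmn, hδ.le]
  have hfin : (touchSites (Λ δ)).Finite := touchSites_finite_of_isFamily hΛ hδ
  -- the row of touch sites of the middle half
  set r : ℝ := (-sideHalfLength α β k + s + (t - s) / 4 + 2 * δ - Y₀ k) / h with hrdef
  set Bs : ℤ := (n k - 2) + 2 * ⌈(r - (n k - 2 : ℤ)) / 2⌉ with hBs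
  obtain ⟨hB1, hB2⟩ := even_step_window (n k - 2) r
  have hrh : r * h = -sideHalfLength α β k + s + (t - s) / 4 + 2 * δ - Y₀ k := div_mul_cancel₀ _ hh0.ne'
  have hlowB : -sideHalfLength α β k + s + (t - s) / 4 + 2 * δ ≤ h * Bs + Y₀ k := by
    have := mul_le_mul_of_nonneg_right hB1 hh0.le; rw [hrh] at this; linarith only [this]
  have hupB : h * Bs + Y₀ k ≤ -sideHalfLength α β k + s + (t - s) / 4 + 2 * δ + 2 * h := by
    have := mul_le_mul_of_nonneg_right hB2 hh0.le; rw [add_mul, hrh] at this; linarith only [this]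
  have hpar : 2 ∣ n k - 2 - Bs := ⟨-⌈(r - (n k - 2 : ℤ)) / 2⌉, by rw [hBs]; ring⟩
  obtain ⟨hN1, hN2⟩ := count_facts (L := t - s) hδ hδL
  set N : ℕ := ⌊((t - s) / 2 - 6 * δ) / (2 * (Real.sqrt 2 / 2 * δ))⌋₊ with hNdef
  rw [← hhdef] at hN2
  have hN : ∀ i : ℕ, i < N → Real.sqrt 2 / 2 * δ * ((Bs : ℝ) + 2 * (i : ℝ)) + Y₀ k ≤
      -sideHalfLength α β k + t - (-sideHalfLength α β k + t - (-sideHalfLength α β k + s)) / 4 := by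
    intro i hi
    have hi' : (i : ℝ) + 1 ≤ N := by exact_mod_cast hi
    have := mul_le_mul_of_nonneg_left hi' (by positivity : (0:ℝ) ≤ 2 * h)
    rw [← hhdef]; linarith only [this, hN2, hupB, hδ.le]
  -- the per-site bound
  have hθ : ∀ i : ℕ, i < N → cg * (1 / 2 * (cA * (((2 * m).toNat + 1 : ℕ) : ℝ) ^ (-((1:ℝ) / 3)))) * cr ≤
      touchProb (Λ δ) site[k + 2, n k - 2, Bs + 2 * (i : ℤ)] := by
    intro i hi
    have hpar_i : 2 ∣ n k - 2 - (Bs + 2 * (i : ℤ)) := by obtain ⟨t', ht'⟩ := hpar; exact ⟨t' - i, by linear_combination ht'⟩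
    have hlow_i : -sideHalfLength α β k + s + (-sideHalfLength α β k + t - (-sideHalfLength α β k + s)) / 4 ≤
        Real.sqrt 2 / 2 * δ * ((Bs + 2 * (i : ℤ) : ℤ) : ℝ) + Y₀ k := by
      have hi0 : (0 : ℝ) ≤ h * (2 * (i : ℝ)) := by positivity
      push_cast; rw [← hhdef]; linarith only [hlowB, hi0, hδ.le]
    have hup_i : Real.sqrt 2 / 2 * δ * ((Bs + 2 * (i : ℤ) : ℤ) : ℝ) + Y₀ k ≤
        -sideHalfLength α β k + t - (-sideHalfLength α β k + t - (-sideHalfLength α β k + s)) / 4 := by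
      push_cast; exact hN i hi
    obtain ⟨hx, htng, hL₁, hL₂⟩ := site_room hδ hch hYp hYq hpar_i hlow_i hup_i hm0 hmh hκ16 hδ60
    have key := hglue D c α β hcar δ hδ (Λ δ) hΩE hEδ hgood X₀ Y₀ n hch h6 k k' _ hx m m lo hm_mg hwT hm1
      (le_mul_of_one_le_left hm0 (by norm_num))
      (h3T k) (by rw [htng]; exact hL₁) (by rw [htng]; exact hL₂) hlo hlo' hQA
    have hR := hring n m k' lo hm_mr hwT hKm
    have hAv := real_armEv_ge hN₀ n k _ hx hm0 hm_N₀
    refine le_trans ?_ key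
    have h1 : 0 ≤ 1 / 2 * (cA * (((2 * m).toNat + 1 : ℕ) : ℝ) ^ (-((1:ℝ) / 3))) := by positivity
    calc cg * (1 / 2 * (cA * (((2 * m).toNat + 1 : ℕ) : ℝ) ^ (-((1:ℝ) / 3)))) * cr
        ≤ cg * (bondPercolation (zdGraph 2) half).real armEv[n, k, site[k + 2, n k - 2, Bs + 2 * (i : ℤ)], 2 * m] * cr := by
          gcongr
      _ ≤ _ := by gcongr
  -- summing over the row
  have hlowB' : -sideHalfLength α β k + s + (-sideHalfLength α β k + t - (-sideHalfLength α β k + s)) / 4 ≤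
      Real.sqrt 2 / 2 * δ * Bs + Y₀ k := by rw [← hhdef]; linarith only [hlowB, hδ.le]
  have hmass := touchMass_ge_of_row he' hδ hα4 hΩ' hEδ hgood' hX' hY' hn hn' hpX hqX hpY hqY hYp hYq hL40 hArc hfin
    hpar hlowB' hN hθ
  refine le_trans ?_ hmass
  have hrate : C₁ * δ ^ ((1:ℝ) / 3) ≤ cg * (1 / 2 * (cA * (((2 * m).toNat + 1 : ℕ) : ℝ) ^ (-((1:ℝ) / 3)))) * cr := by
    refine rate_bound hcg.le hcA.le hcr.le hκ0 hδ hm0 ?_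
    have h22 : Real.sqrt 2 * Real.sqrt 2 = 2 := Real.mul_self_sqrt zero_le_two
    have eh : Real.sqrt 2 * h = δ := by
      rw [hhdef, show Real.sqrt 2 * (Real.sqrt 2 / 2 * δ) = Real.sqrt 2 * Real.sqrt 2 / 2 * δ by ring, h22]; ring
    have e1 : (m : ℝ) * δ ≤ Real.sqrt 2 * κ := by
      have := mul_le_mul_of_nonneg_left hmh (Real.sqrt_nonneg 2)
      rwa [show Real.sqrt 2 * ((m : ℝ) * h) = m * (Real.sqrt 2 * h) by ring, eh] at this
    have e2 : δ ≤ Real.sqrt 2 * κ := by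
      have := mul_le_mul_of_nonneg_left hκh (Real.sqrt_nonneg 2); rwa [eh] at this
    linarith only [e1, e2]
  calc (t - s) / 4 * C₁ = δ ^ ((2:ℝ) / 3) * ((t - s) / 4 / δ) * (C₁ * δ ^ ((1:ℝ) / 3)) := (rpow_two_thirds_mul hδ _ _).symm
    _ ≤ δ ^ ((2:ℝ) / 3) * (N * (cg * (1 / 2 * (cA * (((2 * m).toNat + 1 : ℕ) : ℝ) ^ (-((1:ℝ) / 3)))) * cr)) := by
        rw [mul_assoc]
        refine mul_le_mul_of_nonneg_left (mul_le_mul ?_ hrate (by positivity) (Nat.cast_nonneg N)) (by positivity)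
        rw [div_div]; exact hN1

end Summit.CriticalPhenomena.CardyFormulaZ2.Cruxes.ParafermionToSLESixFamilies.PotentialDarbouxPicardDiamond

end
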